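import Literature.Analysis.FluidPDE.CollisionalTransfer
import Literature.Analysis.FluidPDE.HardSphereCollisionRecord
import Literature.MathematicalPhysics.KineticTheory.HardSphereEuler
import HarnessLib

/-!
# The one-particle velocity ledger along the hard-sphere flow and the PREDICTABLE activity
# budget of the pre-collisional speeds (helper `ccb1_norm_preVel_le` of the line `birth`, crux
# `TwoClocks.EquilibriumFastWindowLD`, stmt-AtomisticToContinuum-14440)

Along a hard-sphere trajectory `γ` in a regular geometry the velocity of a particle `i` is
piecewise constant, right-continuous, and jumps only at the collisions of `i`; the jump at a
collision is read off the ORDERED collision record with `fst = i`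
(`HardSphereCollisionRecord.ofConfig`, `postVel.1 - preVel.1 = v_i⁺ - v_i⁻`). Hence:

* `vel_sub_vel_eq_collisionSum` — the **velocity ledger**: for `a ≤ b`,
  `v_i(b) - v_i(a) = collisionSum_{(a, b]} (if fst = i then v⁺ - v⁻ else 0)`
  (the weak balance law `IsHardSphereTrajectory.sub_eq_integral_add_collisionalTransfer` with the
  observable `w ↦ (w i).2`, whose streaming derivative vanishes, and the identification of the jump
  with the record increment, `sum_contactPairs_ite_fst_eq_jump`);
* `leftLim_vel_eq_add_collisionSum_Ioo` — the **predictable ledger**: for `a < t`,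
  `v_i(t⁻) = v_i(a) + collisionSum_{(a, t)} (if fst = i then v⁺ - v⁻ else 0)` (split `(a, t]` at
  `t`; the current collision is excluded);
* `norm_collisionSum_le` — `‖collisionSum S f‖ ≤ collisionSum S ‖f‖` (finitely many collisions);
* `ccb1_norm_preVel_le` (registered helper) — along the flow on `𝕋³` (`0 < σ < 1/2`), on the good
  set, at a collision at time `t > 0` of the ordered pair `(i, j)`: BOTH recorded pre-collisional
  speeds are bounded by the initial speed plus the kicks of the earlier own records in the OPEN
  window `(0, t)`,
  `‖v_fst⁻‖ ≤ ‖v_i(0)‖ + collisionSum_{(0,t)} (if fst = i then ‖v⁺ - v⁻‖ else 0)` and likewise for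
  `snd` with `j` — i.e. `‖v⁻‖ ≤ ‖v(0)‖ + (τ/σ)·act(t)` for the predictable activity clamp
  `act i t z = (σ/τ) Σ_{(0,t), fst = i} ‖v⁺ - v⁻‖` of the pair-clamped streams of the line `birth`
  (the a-priori finiteness of the angle/partner innovation pressures: a retained record has both
  partners on, so both pre-collisional speeds are `≤ ‖v(0)‖ + Vτ/σ`).

References: Cercignani–Illner–Pulvirenti 1994 §4.2 (elastic collisions along trajectories);
Gallagher–Saint-Raymond–Texier 2013 §4.1; Spohn 1991 Part I §3.2 (weak balance laws).
-/

noncomputable section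

open MeasureTheory Set Filter Function
open scoped ENNReal BigOperators

namespace Summit.AtomisticToContinuum.HydrodynamicLimit.Theorems.ClampedCorrectorBirth

open Literature.Analysis.FluidPDE Literature.MathematicalPhysics.KineticTheory

section Trajectory

variable {d : Type*} [Fintype d] {X : Type*} [TopologicalSpace X] [T2Space X] {n : ℕ}
  {G : Geometry d X} {ε : ℝ} {γ : ℝ → Config n d X}

/-- **The record increment of particle `i` at a collision time is its velocity jump.** At a
collision time `t` of a hard-sphere trajectory in a regular geometry, the sum over the ordered
contact pairs `p` of `if p.1 = i then v_{p.1}⁺ - v_{p.1}⁻ else 0` (read off the records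
`ofConfig (γ t) t p.1 p.2`) is `v_i(t) - v_i(t⁻)`: the two records of the colliding pair `{p, q}`
contribute the jump of `p` and the jump of `q`, and a third particle does not jump. -/
theorem sum_contactPairs_ite_fst_eq_jump (h : IsHardSphereTrajectory G ε n γ)
    (hG : G.IsHardSphereRegular ε) {t : ℝ} (ht : t ∈ collisionTimes G ε γ) (i : Fin n) :
    ∑ p ∈ contactPairs G ε (γ t),
        (if (HardSphereCollisionRecord.ofConfig G ε (γ t) t p.1 p.2).fst = i then
          (HardSphereCollisionRecord.ofConfig G ε (γ t) t p.1 p.2).postVel.1 -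
            (HardSphereCollisionRecord.ofConfig G ε (γ t) t p.1 p.2).preVel.1 else 0) =
      (γ t i).2 - (leftLim γ t i).2 := by
  obtain ⟨⟨p, q⟩, hp⟩ := mem_collisionTimes_iff_contactPairs_nonempty.1 ht
  obtain ⟨hpq, hc⟩ := mem_contactPairs.1 hp
  have hq : (q, p) ∈ contactPairs G ε (γ t) := (swap_mem_contactPairs_iff hG).2 hp
  have hne : (p, q) ≠ (q, p) := fun hpe => hpq (Prod.mk.inj hpe).1
  have hpre_p : (HardSphereCollisionRecord.ofConfig G ε (γ t) t p q).preVel.1 = (leftLim γ t p).2 :=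
    congrArg Prod.fst (h.ofConfig_preVel_eq_leftLim hp)
  have hpre_q : (HardSphereCollisionRecord.ofConfig G ε (γ t) t q p).preVel.1 = (leftLim γ t q).2 :=
    congrArg Prod.fst (h.ofConfig_preVel_eq_leftLim hq)
  rw [h.contactPairs_eq_pair hG hp, Finset.sum_pair hne]
  simp only [HardSphereCollisionRecord.ofConfig_fst, HardSphereCollisionRecord.ofConfig_postVel,
    hpre_p, hpre_q]
  by_cases hip : p = i
  · subst hip
    rw [if_pos rfl, if_neg (Ne.symm hpq), add_zero]
  by_cases hiq : q = i
  · subst hiq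
    rw [if_neg hip, if_pos rfl, zero_add]
  · rw [if_neg hip, if_neg hiq, add_zero,
      h.apply_eq_leftLim_apply_of_ne hpq hc (Ne.symm hip) (Ne.symm hiq), sub_self]

/-- **The velocity ledger of one particle.** Along a hard-sphere trajectory in a regular geometry,
for `a ≤ b` the velocity change of particle `i` over `[a, b]` is the collision sum over the
records in `(a, b]` with `fst = i` of the increments `v⁺ - v⁻` (free flight keeps the velocities,
so the weak balance law has no streaming term; the collisional term is identified record by
record by `sum_contactPairs_ite_fst_eq_jump`). -/
theorem vel_sub_vel_eq_collisionSum (h : IsHardSphereTrajectory G ε n γ)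
    (hG : G.IsHardSphereRegular ε) (i : Fin n) {a b : ℝ} (hab : a ≤ b) :
    (γ b i).2 - (γ a i).2 =
      collisionSum G ε γ (Ioc a b)
        (fun c => if c.fst = i then c.postVel.1 - c.preVel.1 else 0) := by
  have hF : ∀ (z : Config n d X) (t : ℝ),
      HasDerivAt (fun s => (freeFlight G s z i).2) (0 : EuclideanSpace ℝ d) t := fun z t => by
    simp only [freeFlight_apply]
    exact hasDerivAt_const t _
  have hbal := (h.sub_eq_integral_add_collisionalTransfer (F := fun w : Config n d X => (w i).2)
    (F' := fun _ : Config n d X => (0 : EuclideanSpace ℝ d)) hG.continuous_translate_left hF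
    (fun _ => continuous_const) hab).2
  rw [intervalIntegral.integral_zero, zero_add] at hbal
  rw [hbal, collisionalTransfer, collisionSum_eq_collisionPairSum, collisionPairSum]
  refine finsum_mem_congr rfl fun t ht => ?_
  rw [sum_contactPairs_ite_fst_eq_jump h hG ht.1 i, collisionJump]

omit [TopologicalSpace X] [T2Space X] in
/-- Additivity of record collision sums in the window over disjoint sets of times (finitely many
collision times in each; record form of `collisionPairSum_union`). -/
theorem collisionSum_union {M : Type*} [AddCommMonoid M] {S T : Set ℝ}
    (hS : (collisionTimes G ε γ ∩ S).Finite) (hT : (collisionTimes G ε γ ∩ T).Finite)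
    (hST : Disjoint S T) (F : HardSphereCollisionRecord d X n → M) :
    collisionSum G ε γ (S ∪ T) F = collisionSum G ε γ S F + collisionSum G ε γ T F :=
  collisionPairSum_union hS hT hST _

/-- **The predictable ledger.** Along a hard-sphere trajectory in a regular geometry, for `a < t`
the LEFT-limit velocity of particle `i` at `t` is its velocity at `a` plus the collision sum of its
record increments over the OPEN window `(a, t)` — the collision at `t` itself, if any, excluded. -/
theorem leftLim_vel_eq_add_collisionSum_Ioo (h : IsHardSphereTrajectory G ε n γ)
    (hG : G.IsHardSphereRegular ε) (i : Fin n) {a t : ℝ} (hat : a < t) :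
    (leftLim γ t i).2 = (γ a i).2 +
      collisionSum G ε γ (Ioo a t)
        (fun c => if c.fst = i then c.postVel.1 - c.preVel.1 else 0) := by
  have hled := vel_sub_vel_eq_collisionSum h hG i hat.le
  -- split the window `(a, t] = (a, t) ∪ {t}`
  have hfinO : (collisionTimes G ε γ ∩ Ioo a t).Finite :=
    h.finite_collisionTimes_inter_of_subset_Icc Ioo_subset_Icc_self
  have hfinT : (collisionTimes G ε γ ∩ {t}).Finite := (Set.finite_singleton t).subset inter_subset_right
  have hdisj : Disjoint (Ioo a t) {t} := Set.disjoint_singleton_right.2 fun hm => lt_irrefl t hm.2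
  rw [← Ioo_union_right hat, collisionSum_union hfinO hfinT hdisj] at hled
  -- the `{t}` part is the jump at `t` (or `0 = 0` off the collision times)
  have hjump : collisionSum G ε γ {t}
      (fun c => if c.fst = i then c.postVel.1 - c.preVel.1 else 0) =
        (γ t i).2 - (leftLim γ t i).2 := by
    by_cases ht : t ∈ collisionTimes G ε γ
    · have hset : collisionTimes G ε γ ∩ {t} = {t} := inter_eq_right.2 (singleton_subset_iff.2 ht)
      rw [collisionSum_eq_collisionPairSum, collisionPairSum, hset, finsum_mem_singleton]
      exact sum_contactPairs_ite_fst_eq_jump h hG ht i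
    · have hset : collisionTimes G ε γ ∩ {t} = ∅ :=
        Set.eq_empty_iff_forall_notMem.2 fun s hs => ht (mem_singleton_iff.1 hs.2 ▸ hs.1)
      rw [collisionSum_eq_collisionPairSum, collisionPairSum, hset, finsum_mem_empty,
        h.leftLim_eq_of_not_mem hG.continuous_translate_left ht, sub_self]
  rw [hjump] at hled
  -- `v(t) - v(a) = Σ_(a,t) + (v(t) - v(t⁻))`
  have e : (leftLim γ t i).2 = (γ a i).2 + ((γ t i).2 - (γ a i).2 - ((γ t i).2 - (leftLim γ t i).2)) := by
    abel
  rw [e, hled]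
  abel

omit [TopologicalSpace X] [T2Space X] in
/-- **Norms of collision sums**: with finitely many collision times in `S`, the norm of a collision
sum is at most the collision sum of the norms. -/
theorem norm_collisionSum_le {E : Type*} [SeminormedAddCommGroup E] {S : Set ℝ}
    (hfin : (collisionTimes G ε γ ∩ S).Finite) (f : HardSphereCollisionRecord d X n → E) :
    ‖collisionSum G ε γ S f‖ ≤ collisionSum G ε γ S fun c => ‖f c‖ := by
  rw [collisionSum_eq_finset_sum hfin, collisionSum_eq_finset_sum hfin]
  refine (norm_sum_le _ _).trans (Finset.sum_le_sum fun t _ => ?_)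
  exact norm_sum_le _ _

/-- **The predictable activity budget of a pre-collisional speed** (trajectory form). Along a
hard-sphere trajectory in a regular geometry, for `a < t` the left-limit speed of particle `i` at
`t` is at most its speed at `a` plus the collision sum over `(a, t)` of the kicks `‖v⁺ - v⁻‖` of its
own records. -/
theorem norm_leftLim_vel_le (h : IsHardSphereTrajectory G ε n γ) (hG : G.IsHardSphereRegular ε)
    (i : Fin n) {a t : ℝ} (hat : a < t) :
    ‖(leftLim γ t i).2‖ ≤ ‖(γ a i).2‖ +
      collisionSum G ε γ (Ioo a t)
        (fun c => if c.fst = i then ‖c.postVel.1 - c.preVel.1‖ else 0) := by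
  classical
  have hfinO : (collisionTimes G ε γ ∩ Ioo a t).Finite :=
    h.finite_collisionTimes_inter_of_subset_Icc Ioo_subset_Icc_self
  rw [leftLim_vel_eq_add_collisionSum_Ioo h hG i hat]
  refine (norm_add_le _ _).trans (add_le_add le_rfl ?_)
  refine (norm_collisionSum_le hfinO _).trans (le_of_eq ?_)
  simp only [collisionSum_eq_finset_sum hfinO]
  refine Finset.sum_congr rfl fun s _ => Finset.sum_congr rfl fun p _ => ?_
  split_ifs <;> simp

end Trajectory

/-- **Predictable activity budget of the recorded pre-collisional speeds along the hard-sphere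
flow on `𝕋³`.** For reduced diameter `0 < σ < 1/2`, a flow `Φ` of `N + 1` spheres of diameter
`hsDiameter σ N`, a good initial datum `z`, a time `t > 0` and an ordered contact pair `(i, j)` of
the configuration `Φ_t z` (so `t` is a collision time of the orbit and the record
`ofConfig (Φ_t z) t i j` is one of the two records of that collision): the recorded
pre-collisional speed of `fst` is at most `‖v_i(0)‖` plus the sum of the kicks `‖v⁺ - v⁻‖` of the
records with `fst = i` at times in the OPEN window `(0, t)`, and the recorded pre-collisional
speed of `snd` is at most `‖v_j(0)‖` plus the same sum for `j`. (The recorded pre-collisional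
velocities ARE the left limits, `IsHardSphereTrajectory.ofConfig_preVel_eq_leftLim`; then
`norm_leftLim_vel_le` with `a = 0` and `Φ_0 z = z` on the good set.) In the pair-clamped streams
of the line `birth` the sum is `(τ/σ)·act i t z` with the predictable activity clamp `act`, so a
retained record (both partners on before the collision) has both pre-collisional speeds
`≤ ‖v(0)‖ + Vτ/σ`. -/
theorem ccb1_norm_preVel_le : ∀ (σ : ℝ), 0 < σ → σ < 2⁻¹ → ∀ (N : ℕ)
    (Φ : HardSphereFlow (Torus.geometry (Fin 3)) (hsDiameter σ N) (N + 1))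
    (z : Config (N + 1) (Fin 3) T3), z ∈ Φ.good → ∀ (t : ℝ) (i j : Fin (N + 1)), 0 < t →
    (i, j) ∈ contactPairs (Torus.geometry (Fin 3)) (hsDiameter σ N) (Φ.flow t z) →
    ‖(HardSphereCollisionRecord.ofConfig (Torus.geometry (Fin 3)) (hsDiameter σ N) (Φ.flow t z) t
          i j).preVel.1‖ ≤ ‖(z i).2‖ +
        Φ.collisionSum (Set.Ioo 0 t) (fun c => if c.fst = i then ‖c.postVel.1 - c.preVel.1‖ else 0) z ∧
    ‖(HardSphereCollisionRecord.ofConfig (Torus.geometry (Fin 3)) (hsDiameter σ N) (Φ.flow t z) t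
          i j).preVel.2‖ ≤ ‖(z j).2‖ +
        Φ.collisionSum (Set.Ioo 0 t) (fun c => if c.fst = j then ‖c.postVel.1 - c.preVel.1‖ else 0) z := by
  intro σ hσ hσ2 N Φ z hz t i j ht hp
  have hG : (Torus.geometry (Fin 3)).IsHardSphereRegular (hsDiameter σ N) :=
    Torus.isHardSphereRegular_geometry ((hsDiameter_le hσ.le N).trans_lt hσ2)
  have h := Φ.isTrajectory z hz
  have hpre := h.ofConfig_preVel_eq_leftLim (t := t) hp
  have h0 : Φ.flow 0 z = z := Φ.flow_zero z hz
  have hi := norm_leftLim_vel_le h hG i ht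
  have hj := norm_leftLim_vel_le h hG j ht
  simp only [h0] at hi hj
  refine ⟨?_, ?_⟩
  · rw [congrArg Prod.fst hpre]
    exact hi
  · rw [congrArg Prod.snd hpre]
    exact hj

end Summit.AtomisticToContinuum.HydrodynamicLimit.Theorems.ClampedCorrectorBirth
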